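import Literature.Probability.LatticeModels.MagnetizationExponentUpperProofs
import Literature.Probability.LatticeModels.MagnetizationTransport
import Literature.Probability.LatticeModels.SubcriticalFourier
import Mathlib.Analysis.Complex.ExponentialBounds
import HarnessLib

/-!
# The upper half of `β̂ = 1/2` above four dimensions (Aizenman–Fernández 1986), proofs II:
# Fernández–Fröhlich–Sokal §14.4.2, Step 1, on the torus

Topic `Probability/LatticeModels`, namespace `Literature.Probability.LatticeModels`. Second sibling
proof file of `MagnetizationExponentUpper.lean` (after `MagnetizationExponentUpperProofs.lean`),
opened by the `provefact` unit of `Literature.Probability.LatticeModels.spontaneousMagnetization_le_sqrt`.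
No named fact is introduced; the four `def`s of Part C are real-valued finite-volume quantities.

## State of the decomposition

The parent file proves `spontaneousMagnetization_le_sqrt` (AF86, `m*(β) ≤ C (β - β_c)^{1/2}`,
`d ≥ 5`) from the critical-isotherm bound `⟨σ₀⟩⁺_{β_c,h} ≤ C h^{1/3}` (small `h > 0`, `d ≥ 5`;
Aizenman–Fernández 1986, upper half of `δ = 3`; Fernández–Fröhlich–Sokal 1992, (14.282) at `t = 0`)
by the extrapolation principle, and `MagnetizationExponentUpperProofs` reduces that bound to the same
bound below `β_c` (`criticalIsotherm_le_cbrt_of_subcritical`). The isotherm bound is written out as an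
explicit statement wherever it occurs (review of the decomposition under D-0026, 2026-08-15: it is
the whole difficulty of the parent, not an M-sized published input, so it is not kept as a separate
named fact; the theorem names `criticalIsotherm_le_cbrt_of_…` are retained). The printed source of
the remaining step is held: Fernández–Fröhlich–Sokal 1992, §14.4.2 ("Upper bounds on the
magnetization"), Step 1, pp. 352–353, derives `M(t, h) ≤ const × min[χ₀(t) h, B₀(t) h^{1/3}]`
((14.281)) in the whole high-temperature neighbourhood `N₊ = {t ≥ 0, h ≥ 0 small}` from

* the **Aizenman–Fernández (AFe) inequality** (FFS Thm. 12.15, (12.166)/(13.65), proved only in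
  Aizenman–Fernández 1986): `ū₃ ≡ ∂χ/∂h ≤ -[1 - B₀ (tanh h)/M] (tanh h) χ⁴ / (96 B₀ (1 + 2|J|B₀)²)`,
  `B₀` the bubble diagram at `h = 0`;
* the weak GHS inequality ("`h/M(t, h)` is an increasing function of `h`", Case 2) and two
  integrations in `h` ((14.278)–(14.281): Case 1 `B₀h/M > 1/2 ⇒ M < 2B₀h`; Case 2
  `χ(t,h') ≤ (χ₀⁻³ + (3c/4B₀³) h'²)^{-1/3}`, then `M ≤ const B₀ h^{1/3}`);

and Step 2(a) feeds the bubble bound `B₀(t) ≤ const` (`d > 4`) and the extrapolation principle.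
Following Aizenman–Barsky–Fernández 1987, §1 ("In presenting the inequality we restrict our
attention to finite systems; specifically, the squares `(-L, L]^d` with periodic interactions"),
the finite-volume carrier of such differential inequalities is the discrete torus, where the tree
already has the one-point function, its field derivative, GHS, GKS and the comparison with the free
boxes of `ℤ^d` (`MagnetizationTransport`, `GHSInequality`, `GKSInequalities`).

## What is proved here (everything stated; the AFe inequality enters only as a hypothesis)

* Part A: `half_le_tanh` (`x/2 ≤ tanh x` on `[0,1]`), `self_le_rpow_third`.
* Part B, `le_cbrt_of_afe_ode`: **the integration step of FFS §14.4.2 Step 1 in abstract form** —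
  for real functions `m, χ, u` on `(0, S]`, `S ≤ 1`, with `m' = χ > 0`, `χ' = u`, `m(0⁺) = 0`,
  decreasing chord slopes `m(s)/s`, and `u ≤ -κ s χ⁴` wherever `B s ≤ a m(s)`:
  `m(s) ≤ max(B/a, 3(2/(3κ))^{1/3}) s^{1/3}` (Cases 1/2 of FFS, (14.279)–(14.281)).
* Part C: the torus quantities `torusMag` (`M_L = ⟨σ_0⟩_{𝕋_L;β,h}`), `torusSusc`
  (`χ_L = ∑_y ⟨σ_0;σ_y⟩`), `torusU3` (`ū₃,L = ∑_{y,z} u₃(0,y,z)`), `torusBubble`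
  (`B_L(β) = ∑_y ⟨σ_0σ_y⟩²_{h=0}`), with `∂M_L/∂h = β χ_L`, `∂χ_L/∂h = β ū₃,L` (tree field `h`,
  physical field `βh`), `M_L(β,0) = 0`, GHS concavity and the weak GHS inequality
  `M_L(h)/h ≤ M_L(h')/h'` (`h' ≤ h`), `0 ≤ M_L < 1`, `χ_L > 0` — all from tree theorems.
* Part D, `criticalIsotherm_le_cbrt_of_torusMag_le` / `spontaneousMagnetization_le_sqrt_of_torusMag_le`:
  a bound `M_L(β,h) ≤ C h^{1/3}` on all large tori, uniformly for `β ∈ (β₀, β_c)` and small `h`,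
  passes to `⟨σ_0⟩⁺_{β,h}` (free box ≤ torus, box limit, uniqueness of the one-point function at
  `h > 0`) and then to `β = β_c` and to the target.
* Part E, `torusMag_le_cbrt_of_afeShape`, `criticalIsotherm_le_cbrt_of_torusShape`,
  `spontaneousMagnetization_le_sqrt_of_torusShape`: **FFS Step 1 on the torus** — if on all large
  tori below `β_c`, for small `h`, `B βh ≤ a M_L ⇒ ū₃,L ≤ -κ tanh(βh) χ_L⁴` (the shape of (13.65)
  once the torus bubble is bounded uniformly), then the critical-isotherm bound and
  `spontaneousMagnetization_le_sqrt` hold.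

* Part F, `tendsto_torusBubble`, `exists_torusBubble_le`: **the torus bubble below `β_c` is
  bounded uniformly in `d ≥ 5`** — `B_L(β) → ∑_x ⟨σ_0σ_x⟩²_β` as `L → ∞` (`0 ≤ β < β_c`; dominated
  convergence over the centred representatives, from the uniform exponential decay of
  `TorusTwoPointDecay` and the pointwise limit of `TorusTwoPointLimit`/`SubcriticalFourier`), and
  `∑_x ⟨σ_0σ_x⟩²_β ≤ ∑_x ⟨σ_0σ_x⟩²_{β_c} < ∞` (uniqueness below `β_c`, Griffiths monotonicity, and
  the bubble condition `tsum_twoPointFree_criticalBeta_sq_lt_top`): FFS §14.4.2 Step 2 (a),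
  "`B₀(t) ≤ const`", in finite volume.
* Part G, `criticalIsotherm_le_cbrt_of_afeTorus`, `spontaneousMagnetization_le_sqrt_of_afeTorus`:
  **the critical-isotherm bound and the named fact `spontaneousMagnetization_le_sqrt` of the parent
  file from the Aizenman–Fernández inequality (13.65) written verbatim on finite tori** (`ū₃,L ≤ -[1 - B_L tanh(βh)/M_L] tanh(βh) χ_L⁴ / (96 B_L (1 + 2(2dβ)B_L)²)`
  for all `d ≥ 5`, `L`, `β > 0`, `h > 0`), via Part F, `tanh x ≤ x` (proved inline), and Part E
  with `a = 1/2`.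

What then remains of the critical-isotherm bound, of `spontaneousMagnetization_le_sqrt` and of the
target `spontaneousMagnetization_asymp_sqrt` (`Sweep1.lean`) is exactly the hypothesis `hAFe` of Part G: the Aizenman–Fernández inequality on finite periodic systems
(Aizenman–Fernández 1986, random currents with the "dilution trick"; stated as Thm. 12.15/(13.65) in
FFS without proof).

## References

* R. Fernández, J. Fröhlich, A. D. Sokal, *Random Walks, Critical Phenomena, and Triviality in
  Quantum Field Theory*, Springer 1992: Thm. 12.15, (12.166), p. 263; (13.54), p. 288; (13.65),
  p. 290; §14.4.2, (14.277)–(14.284), pp. 351–353 [FernandezFrohlichSokalSpringer1992] (held: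
  `paper:url-4966219460f8`, PDF page = book page + 16).
* M. Aizenman, R. Fernández, J. Stat. Phys. 44 (1986) 393–454, abstract and §1 [AizenmanFernandezJSP1986].
* M. Aizenman, D. J. Barsky, R. Fernández, J. Stat. Phys. 47 (1987) 343–374, §1 [AizenmanBarskyFernandezJSP1987].
* S. Friedli, Y. Velenik, *Statistical Mechanics of Lattice Systems*, CUP 2017, §3.7–3.9 [FriedliVelenik2017].
* G. Slade, *The Lace Expansion and its Applications*, LNM 1879 (2006), §9.3 [Slade2006LaceExpansion].

## Mathlib

`monotoneOn_of_deriv_nonneg`, `ConvexOn.secant_mono`, `HasDerivAt.inv/pow/comp`,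
`Real.rpow` algebra, `Real.cosh_le_cosh`, `Real.self_le_sinh_iff`, `Real.exp_one_lt_three`,
`Real.hasDerivAt_sinh/cosh`, `tendsto_tsum_of_dominated_convergence` (Tannery),
`ENNReal.tsum_coe_ne_top_iff_summable_coe`, `Summable.of_nonneg_of_le`, `Summable.tsum_le_tsum`.
-/

noncomputable section

open Filter Topology Set
open scoped symmDiff

namespace Literature.Probability.LatticeModels

/-! ## Part A. Two elementary inequalities -/

/-- `x/2 ≤ tanh x` for `0 ≤ x ≤ 1` (`sinh x ≥ x`, `cosh x ≤ cosh 1 ≤ 2`). [folklore] -/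
theorem half_le_tanh {x : ℝ} (hx0 : 0 ≤ x) (hx1 : x ≤ 1) : x / 2 ≤ Real.tanh x := by
  rw [Real.tanh_eq_sinh_div_cosh]
  have hcosh : Real.cosh x ≤ 2 := by
    have h1 : Real.cosh x ≤ Real.cosh 1 := by
      rw [Real.cosh_le_cosh, abs_of_nonneg hx0, abs_one]; exact hx1
    have h2 : Real.cosh 1 ≤ 2 := by
      rw [Real.cosh_eq]
      have h3 : Real.exp (-1) ≤ 1 := Real.exp_le_one_iff.2 (by norm_num)
      linarith [Real.exp_one_lt_three]
    exact h1.trans h2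
  have hsinh : x ≤ Real.sinh x := Real.self_le_sinh_iff.2 hx0
  have hcpos := Real.cosh_pos x
  rw [div_le_div_iff₀ (by norm_num : (0 : ℝ) < 2) hcpos]
  nlinarith [mul_le_mul_of_nonneg_left hcosh hx0]

/-- `h ≤ h^{1/3}` for `0 < h ≤ 1`. [folklore] -/
theorem self_le_rpow_third {h : ℝ} (hh0 : 0 < h) (hh1 : h ≤ 1) : h ≤ h ^ (1 / 3 : ℝ) := by
  have := Real.rpow_le_rpow_of_exponent_ge hh0 hh1 (show (1 / 3 : ℝ) ≤ 1 by norm_num)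
  rwa [Real.rpow_one] at this

/-! ## Part B. The integration step of Fernández–Fröhlich–Sokal §14.4.2, Step 1 (abstract form) -/

/-- **Integration of the Aizenman–Fernández differential inequality** (Fernández–Fröhlich–Sokal
1992, §14.4.2, Step 1, eqs. (14.278)–(14.281), abstract real-variable form). Let `m`, `χ`, `u`
be real functions on `(0, S]`, `S ≤ 1`, with `m' = χ > 0`, `χ' = u`, `m(0⁺) = 0`, decreasing
chord slopes `s ↦ m(s)/s` (concavity of `m` with `m(0) = 0`: the "weak GHS inequality"), and the
AFe-type inequality `u ≤ -κ s χ⁴` wherever `B s ≤ a m(s)`. Then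
`m(s) ≤ max(B/a, 3 (2/(3κ))^{1/3}) · s^{1/3}` on `(0, S]`: either `B s > a m(s)` ("Case 1",
(14.279)), or the smallness condition propagates to all `s' ≤ s` by the monotonicity of the chord
slopes, `(χ⁻³)' = -3u/χ⁴ ≥ 3κ s'` integrates to `χ(s') ≤ (2/(3κ))^{1/3} s'^{-2/3}` ((14.280)) and
once more to `m(s) ≤ 3 (2/(3κ))^{1/3} s^{1/3}` ((14.281)). [cite: FernandezFrohlichSokalSpringer1992, §14.4.2, Step 1, eqs. (14.278)–(14.281), pp. 352–353] -/
theorem le_cbrt_of_afe_ode {m χ u : ℝ → ℝ} {S B a κ : ℝ} (hS1 : S ≤ 1)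
    (ha : 0 < a) (hB : 0 ≤ B) (hκ : 0 < κ)
    (hm : ∀ s ∈ Ioc 0 S, HasDerivAt m (χ s) s)
    (hχ : ∀ s ∈ Ioc 0 S, HasDerivAt χ (u s) s)
    (hm0 : Tendsto m (𝓝[>] 0) (𝓝 0))
    (hslope : ∀ s ∈ Ioc 0 S, ∀ s' ∈ Ioc 0 s, m s / s ≤ m s' / s')
    (hχpos : ∀ s ∈ Ioc 0 S, 0 < χ s)
    (hafe : ∀ s ∈ Ioc 0 S, B * s ≤ a * m s → u s ≤ -(κ * s * χ s ^ 4)) :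
    ∀ s ∈ Ioc 0 S, m s ≤ max (B / a) (3 * (2 / (3 * κ)) ^ (1 / 3 : ℝ)) * s ^ (1 / 3 : ℝ) := by
  intro h hh
  have hh0 : 0 < h := hh.1
  have hh1 : h ≤ 1 := hh.2.trans hS1
  have hrpow : h ≤ h ^ (1 / 3 : ℝ) := self_le_rpow_third hh0 hh1
  have hrpow0 : 0 ≤ h ^ (1 / 3 : ℝ) := Real.rpow_nonneg hh0.le _
  set c : ℝ := (2 / (3 * κ)) ^ (1 / 3 : ℝ) with hc
  have hc0 : 0 ≤ c := Real.rpow_nonneg (by positivity) _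
  have hsub : Ioc 0 h ⊆ Ioc 0 S := Ioc_subset_Ioc le_rfl hh.2
  by_cases hcase : B * h ≤ a * m h
  · -- Case 2 of FFS: the smallness condition holds at `h`, hence on all of `(0, h]`
    have hsmall : ∀ s ∈ Ioc 0 h, B * s ≤ a * m s := by
      intro s hs
      have h1 := hslope h hh s hs
      rw [div_le_div_iff₀ hh0 hs.1] at h1
      have h3 : B * s * h ≤ a * m s * h := by
        nlinarith [mul_le_mul_of_nonneg_left h1 ha.le, mul_le_mul_of_nonneg_right hcase hs.1.le]
      exact le_of_mul_le_mul_right h3 hh0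
    have hode : ∀ s ∈ Ioc 0 h, u s ≤ -(κ * s * χ s ^ 4) := fun s hs =>
      hafe s (hsub hs) (hsmall s hs)
    -- `g = χ⁻³ - (3κ/2) s²` is nondecreasing on `(0, h]`
    set g : ℝ → ℝ := fun s => (χ s ^ 3)⁻¹ - 3 * κ / 2 * s ^ 2 with hg
    have hgder : ∀ s ∈ Ioc 0 h, HasDerivAt g
        (-(↑(3 : ℕ) * χ s ^ (3 - 1) * u s) / (χ s ^ 3) ^ 2 - 3 * κ / 2 * (↑(2 : ℕ) * s ^ (2 - 1))) s := by
      intro s hs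
      have hχs := hχpos s (hsub hs)
      have h1 := ((hχ s (hsub hs)).pow 3).inv (pow_ne_zero 3 hχs.ne')
      have h2 := (hasDerivAt_pow 2 s).const_mul (3 * κ / 2)
      exact h1.sub h2
    have hgder_nonneg : ∀ s ∈ Ioc 0 h,
        0 ≤ -(↑(3 : ℕ) * χ s ^ (3 - 1) * u s) / (χ s ^ 3) ^ 2 - 3 * κ / 2 * (↑(2 : ℕ) * s ^ (2 - 1)) := by
      intro s hs
      have hχs := hχpos s (hsub hs)
      have hu := hode s hs
      have hrew : -(↑(3 : ℕ) * χ s ^ (3 - 1) * u s) / (χ s ^ 3) ^ 2 - 3 * κ / 2 * (↑(2 : ℕ) * s ^ (2 - 1))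
          = 3 * (-u s / χ s ^ 4 - κ * s) := by
        push_cast
        field_simp
      rw [hrew]
      refine mul_nonneg (by norm_num) (sub_nonneg.2 ?_)
      rw [le_div_iff₀ (pow_pos hχs 4)]
      linarith
    have hgmono : MonotoneOn g (Ioc 0 h) := by
      refine monotoneOn_of_deriv_nonneg (convex_Ioc 0 h)
        (fun s hs => (hgder s hs).continuousAt.continuousWithinAt)
        (fun s hs => ?_) (fun s hs => ?_)
      · rw [interior_Ioc] at hs
        exact (hgder s (Ioo_subset_Ioc_self hs)).differentiableAt.differentiableWithinAt
      · rw [interior_Ioc] at hs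
        rw [(hgder s (Ioo_subset_Ioc_self hs)).deriv]
        exact hgder_nonneg s (Ioo_subset_Ioc_self hs)
    -- hence `g ≥ 0` on `(0, h]` (let the lower endpoint tend to `0`)
    have hg_nonneg : ∀ s ∈ Ioc 0 h, 0 ≤ g s := by
      intro s hs
      have hlim : Tendsto (fun t : ℝ => -(3 * κ / 2 * t ^ 2)) (𝓝[>] 0) (𝓝 0) := by
        have : Tendsto (fun t : ℝ => -(3 * κ / 2 * t ^ 2)) (𝓝 0) (𝓝 (-(3 * κ / 2 * (0 : ℝ) ^ 2))) :=
          ((continuous_const.mul (continuous_pow 2)).neg).tendsto 0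
        simp only [ne_eq, OfNat.ofNat_ne_zero, not_false_eq_true, zero_pow, mul_zero, neg_zero] at this
        exact this.mono_left nhdsWithin_le_nhds
      refine le_of_tendsto hlim ?_
      filter_upwards [Ioo_mem_nhdsGT hs.1] with t ht
      have htI : t ∈ Ioc 0 h := ⟨ht.1, ht.2.le.trans hs.2⟩
      have h1 : g t ≤ g s := hgmono htI hs ht.2.le
      have h2 : -(3 * κ / 2 * t ^ 2) ≤ g t := by
        have : 0 ≤ (χ t ^ 3)⁻¹ := inv_nonneg.2 (pow_nonneg (hχpos t (hsub htI)).le 3)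
        simp only [hg]
        linarith
      exact h2.trans h1
    -- so `χ(s) ≤ c s^{-2/3}` on `(0, h]`
    have hχle : ∀ s ∈ Ioc 0 h, χ s ≤ c * s ^ (-(2 / 3) : ℝ) := by
      intro s hs
      have hχs := hχpos s (hsub hs)
      have h1 : 3 * κ / 2 * s ^ 2 ≤ (χ s ^ 3)⁻¹ := by
        have := hg_nonneg s hs
        simp only [hg] at this
        linarith
      have hks : 0 < 3 * κ / 2 * s ^ 2 := by have := hs.1; positivity
      have h2 : χ s ^ 3 ≤ (3 * κ / 2 * s ^ 2)⁻¹ := by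
        exact (le_inv_comm₀ hks (pow_pos hχs 3)).1 h1
      have h3 : χ s = (χ s ^ 3) ^ (1 / 3 : ℝ) := by
        rw [one_div]
        exact (Real.pow_rpow_inv_natCast hχs.le (by norm_num : (3 : ℕ) ≠ 0)).symm
      have h4 : (χ s ^ 3) ^ (1 / 3 : ℝ) ≤ ((3 * κ / 2 * s ^ 2)⁻¹) ^ (1 / 3 : ℝ) :=
        Real.rpow_le_rpow (pow_nonneg hχs.le 3) h2 (by norm_num)
      have h5 : ((3 * κ / 2 * s ^ 2)⁻¹) ^ (1 / 3 : ℝ) = c * s ^ (-(2 / 3) : ℝ) := by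
        rw [hc, show (3 * κ / 2 * s ^ 2)⁻¹ = (2 / (3 * κ)) * (s ^ 2)⁻¹ by
          field_simp, Real.mul_rpow (by positivity) (by positivity)]
        congr 1
        rw [← Real.rpow_natCast s 2, ← Real.rpow_neg hs.1.le, ← Real.rpow_mul hs.1.le]
        norm_num
      rw [h3]
      exact h4.trans_eq h5
    -- integrate once more: `F - m` is nondecreasing on `(0, h]`, `F(s) = 3c s^{1/3}`
    set F : ℝ → ℝ := fun s => 3 * c * s ^ (1 / 3 : ℝ) with hF
    have hFder : ∀ s ∈ Ioc 0 h, HasDerivAt F (3 * c * (1 / 3 * s ^ (1 / 3 - 1 : ℝ))) s := by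
      intro s hs
      exact (Real.hasDerivAt_rpow_const (Or.inl hs.1.ne')).const_mul (3 * c)
    have hFmder : ∀ s ∈ Ioc 0 h, HasDerivAt (fun s => F s - m s)
        (3 * c * (1 / 3 * s ^ (1 / 3 - 1 : ℝ)) - χ s) s := fun s hs =>
      (hFder s hs).sub (hm s (hsub hs))
    have hFm_mono : MonotoneOn (fun s => F s - m s) (Ioc 0 h) := by
      refine monotoneOn_of_deriv_nonneg (convex_Ioc 0 h)
        (fun s hs => (hFmder s hs).continuousAt.continuousWithinAt)
        (fun s hs => ?_) (fun s hs => ?_)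
      · rw [interior_Ioc] at hs
        exact (hFmder s (Ioo_subset_Ioc_self hs)).differentiableAt.differentiableWithinAt
      · rw [interior_Ioc] at hs
        have hs' : s ∈ Ioc 0 h := Ioo_subset_Ioc_self hs
        rw [(hFmder s hs').deriv]
        have h1 := hχle s hs'
        have h2 : 3 * c * (1 / 3 * s ^ (1 / 3 - 1 : ℝ)) = c * s ^ (-(2 / 3) : ℝ) := by
          rw [show (1 / 3 - 1 : ℝ) = -(2 / 3) by norm_num]
          ring
        rw [h2]
        linarith
    have hFm_lim : Tendsto (fun s => F s - m s) (𝓝[>] 0) (𝓝 0) := by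
      have hF0 : Tendsto F (𝓝[>] 0) (𝓝 0) := by
        have hcont : Continuous F := continuous_const.mul (Real.continuous_rpow_const (by norm_num))
        have := hcont.tendsto 0
        simp only [hF, Real.zero_rpow (by norm_num : (1 / 3 : ℝ) ≠ 0), mul_zero] at this
        exact this.mono_left nhdsWithin_le_nhds
      simpa using hF0.sub hm0
    have hmain : 0 ≤ F h - m h := by
      refine le_of_tendsto hFm_lim ?_
      filter_upwards [Ioo_mem_nhdsGT hh0] with t ht
      exact hFm_mono ⟨ht.1, ht.2.le⟩ ⟨hh0, le_rfl⟩ ht.2.le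
    have hmF : m h ≤ 3 * c * h ^ (1 / 3 : ℝ) := by
      have : F h = 3 * c * h ^ (1 / 3 : ℝ) := rfl
      linarith
    calc m h ≤ 3 * c * h ^ (1 / 3 : ℝ) := hmF
      _ ≤ max (B / a) (3 * c) * h ^ (1 / 3 : ℝ) :=
          mul_le_mul_of_nonneg_right (le_max_right _ _) hrpow0
  · -- Case 1 of FFS: `B h > a m(h)`, so `m(h) < (B/a) h ≤ (B/a) h^{1/3}`
    rw [not_le] at hcase
    have h1 : m h < B / a * h := by
      rw [div_mul_eq_mul_div, lt_div_iff₀ ha]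
      linarith
    have h2 : B / a * h ≤ B / a * h ^ (1 / 3 : ℝ) :=
      mul_le_mul_of_nonneg_left hrpow (div_nonneg hB ha.le)
    calc m h ≤ B / a * h ^ (1 / 3 : ℝ) := (h1.trans_le h2).le
      _ ≤ max (B / a) (3 * c) * h ^ (1 / 3 : ℝ) :=
          mul_le_mul_of_nonneg_right (le_max_left _ _) hrpow0


/-! ## Part C. The periodic (torus) magnetisation, susceptibility, `ū₃` and bubble -/

section TorusDefs

variable (d L : ℕ) [NeZero L]

/-- The **torus magnetisation** `M_L(β, h) = ⟨σ_0⟩_{𝕋_L;β,h}` of the nearest-neighbour Ising model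
on the discrete torus `(ℤ/Lℤ)^d` (tree parametrisation: weight `exp(β ∑ σσ + β h ∑ σ)`, so the
physical field of Fernández–Fröhlich–Sokal is `β h`; on the whole torus the boundary condition is
immaterial, `isingExpect_univ_fixed`). The finite periodic systems are the carrier of the
differential inequalities of Aizenman–Barsky–Fernández ("the squares `(-L, L]^d` with periodic
interactions", ABF 1987, §1 before (1.9)). [cite: AizenmanBarskyFernandezJSP1987, §1, "In presenting the inequality we restrict our attention to finite systems … with periodic interactions"] [cite: FriedliVelenik2017, Exercise 3.15 (torus), §3.7 eq. (3.41)] -/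
def torusMag (β h : ℝ) : ℝ :=
  isingCorr (torusGraph d L) Finset.univ β h .plus {0}

/-- The **torus susceptibility** `χ_L(β, h) = ∑_y ⟨σ_0; σ_y⟩_{𝕋_L;β,h}` (truncated two-point
function summed over the torus; it is `∂M_L/∂(βh)`, `hasDerivAt_torusMag`; Fernández–Fröhlich–Sokal
1992, (13.22)/(14.1) `χ = ∑_x ⟨φ_0; φ_x⟩`). [cite: FernandezFrohlichSokalSpringer1992, §13.1, eq. (13.22), and §14.1] -/
def torusSusc (β h : ℝ) : ℝ :=
  ∑ y : TorusSite d L,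
    (isingExpect (torusGraph d L) Finset.univ β h .plus (fun σ => spinAt 0 σ * spinAt y σ) -
      isingExpect (torusGraph d L) Finset.univ β h .plus (spinAt 0) *
        isingExpect (torusGraph d L) Finset.univ β h .plus (spinAt y))

/-- The **summed truncated three-point function** `ū₃,L(β, h) = ∑_{y,z} u₃(0, y, z)` on the torus,
`u₃(x,y,z) = ⟨σₓσ_yσ_z⟩ - ⟨σₓσ_y⟩⟨σ_z⟩ - ⟨σₓσ_z⟩⟨σ_y⟩ - ⟨σ_yσ_z⟩⟨σₓ⟩ + 2⟨σₓ⟩⟨σ_y⟩⟨σ_z⟩`; it is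
`∂χ_L/∂(βh) = ∂²M_L/∂(βh)²` (`hasDerivAt_torusSusc`). Fernández–Fröhlich–Sokal 1992, (12.165)
and (13.54): `ū₃ ≡ ∂χ/∂h = ∑_{x,y} ⟨σ_0; σ_x; σ_y⟩`. [cite: FernandezFrohlichSokalSpringer1992, eq. (12.165), p. 262, and (13.54), p. 288] -/
def torusU3 (β h : ℝ) : ℝ :=
  ∑ y : TorusSite d L, ∑ z : TorusSite d L,
    (isingExpect (torusGraph d L) Finset.univ β h .plus (fun σ => spinAt 0 σ * spinAt y σ * spinAt z σ) -
      isingExpect (torusGraph d L) Finset.univ β h .plus (fun σ => spinAt 0 σ * spinAt y σ) *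
        isingExpect (torusGraph d L) Finset.univ β h .plus (spinAt z) -
      isingExpect (torusGraph d L) Finset.univ β h .plus (fun σ => spinAt 0 σ * spinAt z σ) *
        isingExpect (torusGraph d L) Finset.univ β h .plus (spinAt y) -
      isingExpect (torusGraph d L) Finset.univ β h .plus (fun σ => spinAt y σ * spinAt z σ) *
        isingExpect (torusGraph d L) Finset.univ β h .plus (spinAt 0) +
      2 * (isingExpect (torusGraph d L) Finset.univ β h .plus (spinAt 0) *
        isingExpect (torusGraph d L) Finset.univ β h .plus (spinAt y) *
        isingExpect (torusGraph d L) Finset.univ β h .plus (spinAt z)))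

/-- The **torus bubble diagram at zero field** `B_L(β) = ∑_y ⟨σ_0σ_y⟩²_{𝕋_L;β,0}` (the finite-volume
form of the bubble `B₀ = ∑_x ⟨σ_0σ_x⟩²_{h=0}` of Fernández–Fröhlich–Sokal 1992, (12.49)/(13.65):
"`B₀` denotes the bubble diagram evaluated at `h = 0`"). [cite: FernandezFrohlichSokalSpringer1992, Thm. 12.15, p. 263 ("B₀ denotes the bubble diagram (12.49) evaluated at h = 0")] -/
def torusBubble (β : ℝ) : ℝ :=
  ∑ y : TorusSite d L, isingTorusTwoPoint d L β 0 0 y ^ 2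

variable {d L}

/-- `M_L(β,h) = ⟨σ_0⟩` as the expectation of `spinAt 0`. [folklore] -/
theorem torusMag_eq_isingExpect (β h : ℝ) :
    torusMag d L β h = isingExpect (torusGraph d L) Finset.univ β h .plus (spinAt 0) := by
  rw [torusMag, isingCorr, spinProduct_singleton]

/-- **`∂M_L/∂h = β χ_L`** (tree field; Friedli–Velenik 2017, Lemma 3.31 (1), proof): the tree
theorem `hasDerivAt_isingExpect_spinAt_field` on the torus. [cite: FriedliVelenik2017, Lemma 3.31 (1), proof, p. 119] -/
theorem hasDerivAt_torusMag (β h : ℝ) :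
    HasDerivAt (fun h => torusMag d L β h) (β * torusSusc d L β h) h := by
  have hfun : (fun h => torusMag d L β h) =
      fun h => isingExpect (torusGraph d L) Finset.univ β h .plus (spinAt 0) := by
    funext h; exact torusMag_eq_isingExpect β h
  rw [hfun]
  exact hasDerivAt_isingExpect_spinAt_field (torusGraph d L) Finset.univ β h .plus 0

/-- **`∂χ_L/∂h = β ū₃,L`** (tree field): the tree theorem `hasDerivAt_isingTrunc_field` summed over
the torus. [cite: FernandezFrohlichSokalSpringer1992, eq. (12.165), p. 262] -/
theorem hasDerivAt_torusSusc (β h : ℝ) :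
    HasDerivAt (fun h => torusSusc d L β h) (β * torusU3 d L β h) h := by
  unfold torusSusc torusU3
  rw [Finset.mul_sum]
  exact HasDerivAt.fun_sum fun y _ =>
    hasDerivAt_isingTrunc_field (torusGraph d L) Finset.univ β h .plus 0 y

/-- `h ↦ M_L(β, h)` is continuous. [folklore] -/
theorem continuous_torusMag (β : ℝ) : Continuous fun h => torusMag d L β h :=
  continuous_iff_continuousAt.2 fun h => (hasDerivAt_torusMag β h).continuousAt

/-- **`M_L(β, 0) = 0`** (spin-flip symmetry at zero field, Friedli–Velenik 2017, eq. (3.33)). [cite: FriedliVelenik2017, §3.7.1, eq. (3.33)] -/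
theorem torusMag_zero_field (β : ℝ) : torusMag d L β 0 = 0 := by
  rw [torusMag, isingCorr, show (BoundaryCondition.plus : BoundaryCondition (TorusSite d L)) =
    .fixed 1 from rfl, isingExpect_univ_fixed, ← isingCorr]
  exact isingCorr_free_singleton_zero_field (torusGraph d L) Finset.univ β (Finset.mem_univ 0)

/-- **GHS concavity of `h ↦ M_L(β, h)` on `[0, ∞)`** (`β ≥ 0`): the tree theorem
`concaveOn_isingCorr_singleton` on the torus. [cite: FriedliVelenik2017, Remark 3.41 (p. 126) and §3.9, p. 140] -/
theorem concaveOn_torusMag {β : ℝ} (hβ : 0 ≤ β) :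
    ConcaveOn ℝ (Ici 0) (fun h => torusMag d L β h) :=
  concaveOn_isingCorr_singleton (torusGraph d L) hβ (Or.inr rfl) (Finset.mem_univ 0)

/-- **The weak GHS inequality on the torus** ("`h/M` is an increasing function of `h`",
Fernández–Fröhlich–Sokal 1992, §14.4.2, Step 1, Case 2): for `β ≥ 0` and `0 < h' ≤ h`,
`M_L(β,h)/h ≤ M_L(β,h')/h'` (secants through the origin of a concave function vanishing at `0`). [cite: FernandezFrohlichSokalSpringer1992, §14.4.2, Step 1 (Case 2), p. 352] -/
theorem torusMag_div_le_torusMag_div {β : ℝ} (hβ : 0 ≤ β) {h h' : ℝ} (hh' : 0 < h') (hh'h : h' ≤ h) :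
    torusMag d L β h / h ≤ torusMag d L β h' / h' := by
  have hconv := (concaveOn_torusMag (d := d) (L := L) hβ).neg
  have hh : 0 < h := hh'.trans_le hh'h
  have key := hconv.secant_mono (a := 0) (x := h') (y := h) (self_mem_Ici) (mem_Ici.2 hh'.le)
    (mem_Ici.2 hh.le) hh'.ne' hh.ne' hh'h
  simp only [Pi.neg_apply, torusMag_zero_field, neg_zero, sub_zero] at key
  rw [neg_div, neg_div, neg_le_neg_iff] at key
  exact key

/-- In a finite spin system `ν_{Λ;K}` every one-point function is `< 1` (the all-minus
configuration has positive weight). [folklore] -/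
theorem gksExpect_spinAt_lt_one {Λ : Type*} [Fintype Λ] [DecidableEq Λ] {ι : Type*}
    (s : Finset ι) (K : ι → ℝ) (C : ι → Finset Λ) (a : Λ) : gksExpect s K C (spinAt a) < 1 := by
  rw [gksExpect, div_lt_one (gksSum_one_pos _ _ _), gksSum, gksSum]
  refine Finset.sum_lt_sum (fun ω _ => ?_) ⟨fun _ => -1, Finset.mem_univ _, ?_⟩
  · refine mul_le_mul_of_nonneg_right ?_ (gksWeight_pos s K C ω).le
    rcases spinAt_eq_one_or_eq_neg_one a ω with h | h <;> norm_num [h]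
  · have h1 : spinAt a (fun _ : Λ => (-1 : ℤˣ)) = -1 := by simp [spinAt]
    have h2 := gksWeight_pos s K C (fun _ : Λ => (-1 : ℤˣ))
    rw [h1]
    linarith

/-- `M_L(β, h) < 1`. [folklore] -/
theorem torusMag_lt_one (β h : ℝ) : torusMag d L β h < 1 := by
  rw [torusMag, isingCorr_singleton_eq_gksExpect (torusGraph d L) Finset.univ β h .plus (Finset.mem_univ 0)]
  exact gksExpect_spinAt_lt_one _ _ _ _

/-- `0 ≤ M_L(β, h)` for `β, h ≥ 0` (GKS I). [cite: FriedliVelenik2017, Thm. 3.20, eq. (3.21)] -/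
theorem torusMag_nonneg {β h : ℝ} (hβ : 0 ≤ β) (hh : 0 ≤ h) : 0 ≤ torusMag d L β h :=
  GKSInequalities.gks_one_holds (torusGraph d L) hβ hh (Or.inr rfl) (Finset.subset_univ _)

/-- **`χ_L(β, h) > 0`** for `β, h ≥ 0`: every term `⟨σ_0; σ_y⟩ ≥ 0` (GKS II) and the diagonal term
is `1 - M_L² > 0`. [cite: FriedliVelenik2017, Thm. 3.20, eq. (3.22) (GKS II)] -/
theorem torusSusc_pos {β h : ℝ} (hβ : 0 ≤ β) (hh : 0 ≤ h) : 0 < torusSusc d L β h := by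
  unfold torusSusc
  have e2 : ∀ y : TorusSite d L, isingExpect (torusGraph d L) Finset.univ β h .plus (spinAt y) =
      isingCorr (torusGraph d L) Finset.univ β h .plus {y} := fun y => by
    rw [isingCorr, spinProduct_singleton]
  have hterm : ∀ y : TorusSite d L, 0 ≤
      isingExpect (torusGraph d L) Finset.univ β h .plus (fun σ => spinAt 0 σ * spinAt y σ) -
        isingExpect (torusGraph d L) Finset.univ β h .plus (spinAt 0) *
          isingExpect (torusGraph d L) Finset.univ β h .plus (spinAt y) := by
    intro y
    have h2 := GKSInequalities.gks_two_holds (torusGraph d L) (Λ := Finset.univ) (A := {0}) (B := {y})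
      hβ hh (Or.inr rfl) (Finset.subset_univ _) (Finset.subset_univ _)
    have e1 : isingExpect (torusGraph d L) Finset.univ β h .plus (fun σ => spinAt 0 σ * spinAt y σ) =
        isingCorr (torusGraph d L) Finset.univ β h .plus ({0} ∆ {y}) := by
      rw [← isingTwoPoint_eq_isingCorr_symmDiff]; rfl
    rw [e1, e2, e2]
    linarith
  have hdiag : 0 < isingExpect (torusGraph d L) Finset.univ β h .plus (fun σ => spinAt 0 σ * spinAt 0 σ) -
      isingExpect (torusGraph d L) Finset.univ β h .plus (spinAt 0) *
        isingExpect (torusGraph d L) Finset.univ β h .plus (spinAt 0) := by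
    have e1 : isingExpect (torusGraph d L) Finset.univ β h .plus (fun σ => spinAt 0 σ * spinAt 0 σ) = 1 := by
      simp only [spinAt_mul_self]
      exact isingExpect_const (torusGraph d L) Finset.univ β h .plus 1
    rw [e1, ← torusMag_eq_isingExpect]
    have h1 := torusMag_lt_one (d := d) (L := L) β h
    have h5 := torusMag_nonneg (d := d) (L := L) hβ hh
    nlinarith
  exact Finset.sum_pos' (fun y _ => hterm y) ⟨0, Finset.mem_univ _, hdiag⟩

end TorusDefs

/-! ## Part D. From a bound on the torus magnetisation to the critical isotherm and the target -/

section Limit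

variable {d : ℕ}

/-- **Torus bounds pass to the free state**: if `M_L(β, h) ≤ C` for all large `L`, then
`⟨σ_0⟩^∅_{β,h} ≤ C` (`β, h ≥ 0`): the free box `Λ_M` sits isometrically in every torus with
`L > 2M + 1` and has the smaller one-point function (`isingCorr_freeBox_le_torus`, Griffiths), and
`⟨σ_0⟩^∅_{Λ_M} → ⟨σ_0⟩^∅` (`hasBoxLimit_isingCorr_free_holds`). [cite: FriedliVelenik2017, Exercise 3.31 and Exercise 3.16, p. 115] -/
theorem freeCorr_singleton_le_of_torusMag_le {β h C : ℝ} (hβ : 0 ≤ β) (hh : 0 ≤ h) {L₀ : ℕ}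
    (H : ∀ L : ℕ, L₀ ≤ L → ∀ [NeZero L], torusMag d L β h ≤ C) : freeCorr d β h {0} ≤ C := by
  have hconv : Tendsto (fun M : ℕ => isingCorr (zdGraph d) (box d M) β h .free {0}) atTop
      (𝓝 (freeCorr d β h {0})) := hasBoxLimit_isingCorr_free_holds (d := d) hβ hh {0}
  refine le_of_tendsto hconv (Eventually.of_forall fun M => ?_)
  haveI : NeZero (max L₀ (2 * M + 2)) := ⟨by omega⟩
  have h1 := isingCorr_freeBox_le_torus (d := d) (L := max L₀ (2 * M + 2)) (M := M) (by omega) hβ hh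
  exact h1.trans (H (max L₀ (2 * M + 2)) (le_max_left _ _))

/-- **Torus bounds pass to the magnetisation in a field** (`d ≥ 1`, `β ≥ 0`, `h > 0`):
`m(β, h) = ⟨σ_0⟩⁺_{β,h} = ⟨σ_0⟩^∅_{β,h}` (uniqueness of the one-point function at `h > 0`, the
tree theorem `freeCorr_eq_plusCorr_singleton_of_pos_holds`, Friedli–Velenik 2017, Thm. 3.25 (1))
and `freeCorr_singleton_le_of_torusMag_le`. [cite: FriedliVelenik2017, Thm. 3.25 (1), p. 116] -/
theorem magnetizationInField_le_of_torusMag_le (hd : 1 ≤ d) {β h C : ℝ} (hβ : 0 ≤ β) (hh : 0 < h)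
    {L₀ : ℕ} (H : ∀ L : ℕ, L₀ ≤ L → ∀ [NeZero L], torusMag d L β h ≤ C) :
    magnetizationInField d β h ≤ C := by
  rw [magnetizationInField_eq_plusCorr, ← freeCorr_eq_plusCorr_singleton_of_pos_holds hd hβ hh]
  exact freeCorr_singleton_le_of_torusMag_le hβ hh.le H

/-- **The critical-isotherm bound from a uniform bound on the torus magnetisation below `β_c`.**
If for `d ≥ 5` there are `C`, `h₁ > 0`, `β₀ < β_c` such that for every `β ∈ (β₀, β_c)`, `β > 0`,
all large tori satisfy `M_L(β, h) ≤ C h^{1/3}` for `h ∈ (0, h₁)`, then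
`⟨σ_0⟩⁺_{β_c,h} ≤ C h^{1/3}` for `h ∈ (0, h₁)`: thermodynamic limit
(`magnetizationInField_le_of_torusMag_le`) and the passage `β ↑ β_c`
(`criticalIsotherm_le_cbrt_of_subcritical`; Slade 2006, (9.62)–(9.63), for the Ising model
Fernández–Fröhlich–Sokal 1992, §14.4.2). [cite: FernandezFrohlichSokalSpringer1992, §14.4.2, Step 1, eqs. (14.278)–(14.282), pp. 352–353] [cite: Slade2006LaceExpansion, §9.3, proof of Thm. 9.10, (9.61)–(9.63)] -/
theorem criticalIsotherm_le_cbrt_of_torusMag_le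
    (H : ∀ ⦃d : ℕ⦄, 5 ≤ d → ∃ C h₁ β₀ : ℝ, 0 < h₁ ∧ β₀ < criticalBeta d ∧
      ∀ β ∈ Set.Ioo β₀ (criticalBeta d), 0 < β → ∃ L₀ : ℕ, ∀ L : ℕ, L₀ ≤ L → ∀ [NeZero L],
        ∀ h ∈ Set.Ioo (0 : ℝ) h₁, torusMag d L β h ≤ C * h ^ (1 / 3 : ℝ)) :
    ∀ ⦃d : ℕ⦄, 5 ≤ d → ∃ C h₁ : ℝ, 0 < h₁ ∧ ∀ h ∈ Set.Ioo (0 : ℝ) h₁,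
      magnetizationInField d (criticalBeta d) h ≤ C * h ^ (1 / 3 : ℝ) := by
  refine criticalIsotherm_le_cbrt_of_subcritical fun d hd => ?_
  obtain ⟨C, h₁, β₀, hh₁, hβ₀, hC⟩ := H hd
  have hβc : 0 < criticalBeta d := criticalBeta_pos_holds (d := d) (by omega)
  refine ⟨C, h₁, max β₀ (criticalBeta d / 2), hh₁, max_lt hβ₀ (by linarith), fun β hβ h hh => ?_⟩
  have hβ0 : 0 < β := lt_of_le_of_lt (by positivity) ((le_max_right β₀ _).trans_lt hβ.1)
  obtain ⟨L₀, hL₀⟩ := hC β ⟨(le_max_left _ _).trans_lt hβ.1, hβ.2⟩ hβ0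
  exact magnetizationInField_le_of_torusMag_le (by omega) hβ0.le hh.1 fun L hL _ => hL₀ L hL h hh

/-- **The target from a uniform bound on the torus magnetisation below `β_c`**
(`criticalIsotherm_le_cbrt_of_torusMag_le`, then the extrapolation principle of the parent file,
`spontaneousMagnetization_le_sqrt_of_criticalIsotherm`). [cite: FernandezFrohlichSokalSpringer1992, §14.4.2, Steps 1–2(a), eqs. (14.278)–(14.284), pp. 352–353] -/
theorem spontaneousMagnetization_le_sqrt_of_torusMag_le
    (H : ∀ ⦃d : ℕ⦄, 5 ≤ d → ∃ C h₁ β₀ : ℝ, 0 < h₁ ∧ β₀ < criticalBeta d ∧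
      ∀ β ∈ Set.Ioo β₀ (criticalBeta d), 0 < β → ∃ L₀ : ℕ, ∀ L : ℕ, L₀ ≤ L → ∀ [NeZero L],
        ∀ h ∈ Set.Ioo (0 : ℝ) h₁, torusMag d L β h ≤ C * h ^ (1 / 3 : ℝ)) :
    spontaneousMagnetization_le_sqrt :=
  spontaneousMagnetization_le_sqrt_of_criticalIsotherm (criticalIsotherm_le_cbrt_of_torusMag_le H)

end Limit

/-! ## Part E. Step 1 of Fernández–Fröhlich–Sokal §14.4.2 on the torus -/

section Shape

variable {d L : ℕ} [NeZero L]

/-- **FFS §14.4.2, Step 1, on one torus at one `β > 0`.** Suppose that for `h ∈ (0, h₀]`,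
`β h₀ ≤ 1`, the AFe-type inequality `ū₃,L ≤ -κ tanh(βh) χ_L⁴` holds whenever `B βh ≤ a M_L`
(`κ, a > 0`, `B ≥ 0`; for the Aizenman–Fernández inequality (13.65) `B` is the bubble and
`a = 1/2`). Then `M_L(β, h) ≤ max(B/a, 3 (4/(3κ))^{1/3}) (βh)^{1/3}` for `h ∈ (0, h₀]`: the
abstract integration `le_cbrt_of_afe_ode` in the physical field `s = βh`, fed with
`∂M_L/∂s = χ_L > 0`, `∂χ_L/∂s = ū₃,L` (`hasDerivAt_torusMag`, `hasDerivAt_torusSusc`,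
`torusSusc_pos`), `M_L(β, 0) = 0`, the weak GHS inequality (`torusMag_div_le_torusMag_div`) and
`tanh s ≥ s/2` on `[0, 1]`. [cite: FernandezFrohlichSokalSpringer1992, §14.4.2, Step 1, eqs. (14.278)–(14.281), pp. 352–353] -/
theorem torusMag_le_cbrt_of_afeShape {β h₀ κ a B : ℝ} (hβ : 0 < β) (hS : β * h₀ ≤ 1)
    (hκ : 0 < κ) (ha : 0 < a) (hB : 0 ≤ B)
    (hafe : ∀ h ∈ Ioc (0 : ℝ) h₀, B * (β * h) ≤ a * torusMag d L β h →
      torusU3 d L β h ≤ -(κ * Real.tanh (β * h) * torusSusc d L β h ^ 4)) :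
    ∀ h ∈ Ioc (0 : ℝ) h₀, torusMag d L β h ≤
      max (B / a) (3 * (2 / (3 * (κ / 2))) ^ (1 / 3 : ℝ)) * (β * h) ^ (1 / 3 : ℝ) := by
  -- physical reparametrisation `s = β h`
  set m : ℝ → ℝ := fun s => torusMag d L β (s / β) with hm
  set χ : ℝ → ℝ := fun s => torusSusc d L β (s / β) with hχ
  set u : ℝ → ℝ := fun s => torusU3 d L β (s / β) with hu
  have hββ : ∀ s : ℝ, β * (s / β) = s := fun s => by field_simp
  have hdiv : ∀ s, HasDerivAt (fun s : ℝ => s / β) (1 / β) s := fun s => by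
    simpa using (hasDerivAt_id s).div_const β
  have hmder : ∀ s, HasDerivAt m (χ s) s := by
    intro s
    have h1 := (hasDerivAt_torusMag (d := d) (L := L) β (s / β)).comp s (hdiv s)
    have h2 : β * torusSusc d L β (s / β) * (1 / β) = χ s := by
      simp only [hχ]; field_simp
    exact h2 ▸ h1
  have hχder : ∀ s, HasDerivAt χ (u s) s := by
    intro s
    have h1 := (hasDerivAt_torusSusc (d := d) (L := L) β (s / β)).comp s (hdiv s)
    have h2 : β * torusU3 d L β (s / β) * (1 / β) = u s := by
      simp only [hu]; field_simp
    exact h2 ▸ h1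
  have hm0 : Tendsto m (𝓝[>] 0) (𝓝 0) := by
    have hc : Continuous m :=
      (continuous_torusMag (d := d) (L := L) β).comp (continuous_id.div_const β)
    have := hc.tendsto 0
    rw [show m 0 = 0 by simp only [hm, zero_div, torusMag_zero_field]] at this
    exact this.mono_left nhdsWithin_le_nhds
  have hslope : ∀ s ∈ Ioc (0 : ℝ) (β * h₀), ∀ s' ∈ Ioc (0 : ℝ) s, m s / s ≤ m s' / s' := by
    intro s hs s' hs'
    have hs0 : 0 < s := hs'.1.trans_le hs'.2
    have h1 := torusMag_div_le_torusMag_div (d := d) (L := L) hβ.le (h := s / β) (h' := s' / β)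
      (div_pos hs'.1 hβ) (div_le_div_of_nonneg_right hs'.2 hβ.le)
    have e : ∀ t : ℝ, torusMag d L β (t / β) / (t / β) / β = m t / t := fun t => by
      rw [div_div, div_mul_cancel₀ t hβ.ne']
    rw [← e, ← e]
    exact div_le_div_of_nonneg_right h1 hβ.le
  have hχpos : ∀ s ∈ Ioc (0 : ℝ) (β * h₀), 0 < χ s := fun s hs =>
    torusSusc_pos hβ.le (div_pos hs.1 hβ).le
  have hafe' : ∀ s ∈ Ioc (0 : ℝ) (β * h₀), B * s ≤ a * m s → u s ≤ -(κ / 2 * s * χ s ^ 4) := by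
    intro s hs hsmall
    have hsβ : s / β ∈ Ioc 0 h₀ :=
      ⟨div_pos hs.1 hβ, by rw [div_le_iff₀ hβ]; linarith [hs.2]⟩
    have key := hafe (s / β) hsβ (by rw [hββ]; exact hsmall)
    rw [hββ] at key
    have htanh : s / 2 ≤ Real.tanh s := half_le_tanh hs.1.le (hs.2.trans hS)
    have hx4 : 0 ≤ κ * χ s ^ 4 := by positivity
    have key' : u s ≤ -(κ * Real.tanh s * χ s ^ 4) := key
    nlinarith [mul_le_mul_of_nonneg_left htanh hx4]
  have main := le_cbrt_of_afe_ode (S := β * h₀) hS ha hB (half_pos hκ) (fun s _ => hmder s)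
    (fun s _ => hχder s) hm0 hslope hχpos hafe'
  intro h hh
  have hs : β * h ∈ Ioc 0 (β * h₀) := ⟨mul_pos hβ hh.1, mul_le_mul_of_nonneg_left hh.2 hβ.le⟩
  have := main (β * h) hs
  have e : m (β * h) = torusMag d L β h := by
    simp only [hm, mul_div_cancel_left₀ h hβ.ne']
  rwa [e] at this

/-- **The critical-isotherm bound from an Aizenman–Fernández-type inequality on large tori below
`β_c`.** If for `d ≥ 5` there are `β₀ < β_c`, `h₀, κ, a > 0`, `B ≥ 0` such that for every
`β ∈ (β₀, β_c)`, `β > 0`, all large tori `(ℤ/Lℤ)^d` satisfy, for `h ∈ (0, h₀]`,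
`B βh ≤ a M_L(β,h) ⟹ ū₃,L(β,h) ≤ -κ tanh(βh) χ_L(β,h)⁴` — which is what the Aizenman–Fernández
inequality (13.65) of Fernández–Fröhlich–Sokal together with a uniform bound on the torus bubble
gives — then `⟨σ_0⟩⁺_{β_c,h} ≤ C h^{1/3}` for small `h > 0` (FFS §14.4.2, Step 1, on the torus:
`torusMag_le_cbrt_of_afeShape` with `h₁ = min(h₀, 1/β_c)` and the uniform constant
`max(B/a, 3(4/(3κ))^{1/3}) β_c^{1/3}`, then `criticalIsotherm_le_cbrt_of_torusMag_le`). The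
Aizenman–Fernández inequality itself (Aizenman–Fernández 1986; FFS Thm. 12.15) is NOT proved
here. [cite: FernandezFrohlichSokalSpringer1992, §14.4.2, Step 1, eqs. (14.278)–(14.282), pp. 352–353, with Thm. 12.15 / eq. (13.65), pp. 263, 290] [cite: AizenmanFernandezJSP1986, abstract and §1 (δ = 3 for nearest-neighbour models, d > 4; Zbl 0629.60106)] -/
theorem criticalIsotherm_le_cbrt_of_torusShape
    (H : ∀ ⦃d : ℕ⦄, 5 ≤ d → ∃ β₀ h₀ κ a B : ℝ, β₀ < criticalBeta d ∧ 0 < h₀ ∧ 0 < κ ∧ 0 < a ∧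
      0 ≤ B ∧ ∀ β ∈ Set.Ioo β₀ (criticalBeta d), 0 < β → ∃ L₀ : ℕ, ∀ L : ℕ, L₀ ≤ L →
        ∀ [NeZero L], ∀ h ∈ Set.Ioc (0 : ℝ) h₀, B * (β * h) ≤ a * torusMag d L β h →
          torusU3 d L β h ≤ -(κ * Real.tanh (β * h) * torusSusc d L β h ^ 4)) :
    ∀ ⦃d : ℕ⦄, 5 ≤ d → ∃ C h₁ : ℝ, 0 < h₁ ∧ ∀ h ∈ Set.Ioo (0 : ℝ) h₁,
      magnetizationInField d (criticalBeta d) h ≤ C * h ^ (1 / 3 : ℝ) := by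
  refine criticalIsotherm_le_cbrt_of_torusMag_le fun d hd => ?_
  obtain ⟨β₀, h₀, κ, a, B, hβ₀, hh₀, hκ, ha, hB, hH⟩ := H hd
  have hβc : 0 < criticalBeta d := criticalBeta_pos_holds (d := d) (by omega)
  set K : ℝ := max (B / a) (3 * (2 / (3 * (κ / 2))) ^ (1 / 3 : ℝ)) with hK
  have hK0 : 0 ≤ K := le_max_of_le_left (div_nonneg hB ha.le)
  have hic : (0 : ℝ) < 1 / criticalBeta d := by positivity
  refine ⟨K * criticalBeta d ^ (1 / 3 : ℝ), min h₀ (1 / criticalBeta d), β₀, lt_min hh₀ hic, hβ₀,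
    fun β hβ hβ0 => ?_⟩
  obtain ⟨L₀, hL₀⟩ := hH β hβ hβ0
  refine ⟨L₀, fun L hL _ h hh => ?_⟩
  have hS : β * min h₀ (1 / criticalBeta d) ≤ 1 := by
    have h2 : β * min h₀ (1 / criticalBeta d) ≤ criticalBeta d * (1 / criticalBeta d) :=
      mul_le_mul hβ.2.le (min_le_right _ _) (by positivity) hβc.le
    rwa [mul_one_div_cancel hβc.ne'] at h2
  have step := torusMag_le_cbrt_of_afeShape (d := d) (L := L) hβ0 hS hκ ha hB
    (fun h' hh' hsm => hL₀ L hL h' ⟨hh'.1, hh'.2.trans (min_le_left _ _)⟩ hsm) h ⟨hh.1, hh.2.le⟩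
  calc torusMag d L β h ≤ K * (β * h) ^ (1 / 3 : ℝ) := step
    _ = K * β ^ (1 / 3 : ℝ) * h ^ (1 / 3 : ℝ) := by rw [Real.mul_rpow hβ0.le hh.1.le, mul_assoc]
    _ ≤ K * criticalBeta d ^ (1 / 3 : ℝ) * h ^ (1 / 3 : ℝ) := by
        have h1 : β ^ (1 / 3 : ℝ) ≤ criticalBeta d ^ (1 / 3 : ℝ) :=
          Real.rpow_le_rpow hβ0.le hβ.2.le (by norm_num)
        have h2 : 0 ≤ h ^ (1 / 3 : ℝ) := Real.rpow_nonneg hh.1.le _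
        exact mul_le_mul_of_nonneg_right (mul_le_mul_of_nonneg_left h1 hK0) h2

/-- **The target from an Aizenman–Fernández-type inequality on large tori below `β_c`**
(`criticalIsotherm_le_cbrt_of_torusShape` and the extrapolation principle,
`spontaneousMagnetization_le_sqrt_of_criticalIsotherm`). [cite: FernandezFrohlichSokalSpringer1992, §14.4.2, Steps 1–2(a), eqs. (14.278)–(14.284), pp. 352–353] [cite: AizenmanFernandezJSP1986, abstract and §1 (β = 1/2 for nearest-neighbour models, d > 4; Zbl 0629.60106)] -/
theorem spontaneousMagnetization_le_sqrt_of_torusShape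
    (H : ∀ ⦃d : ℕ⦄, 5 ≤ d → ∃ β₀ h₀ κ a B : ℝ, β₀ < criticalBeta d ∧ 0 < h₀ ∧ 0 < κ ∧ 0 < a ∧
      0 ≤ B ∧ ∀ β ∈ Set.Ioo β₀ (criticalBeta d), 0 < β → ∃ L₀ : ℕ, ∀ L : ℕ, L₀ ≤ L →
        ∀ [NeZero L], ∀ h ∈ Set.Ioc (0 : ℝ) h₀, B * (β * h) ≤ a * torusMag d L β h →
          torusU3 d L β h ≤ -(κ * Real.tanh (β * h) * torusSusc d L β h ^ 4)) :
    spontaneousMagnetization_le_sqrt :=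
  spontaneousMagnetization_le_sqrt_of_criticalIsotherm (criticalIsotherm_le_cbrt_of_torusShape H)

end Shape

/-! ## Part F. The torus bubble below `β_c` is bounded by the critical bubble (`d ≥ 5`) -/

section Bubble

variable {d : ℕ}

/-- **The critical bubble is summable (as a real series) for `d ≥ 5`**: the tree theorem
`tsum_twoPointFree_criticalBeta_sq_lt_top` (infrared bound) transcribed from `ℝ≥0∞`. [cite: Sakai2007, §1.1 (bubble condition above four dimensions)] -/
theorem summable_twoPointFree_criticalBeta_sq (hd : 5 ≤ d) :
    Summable fun x : Site d => twoPointFree d (criticalBeta d) x ^ 2 := by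
  have hlt := tsum_twoPointFree_criticalBeta_sq_lt_top (d := d) hd
  have hβc : 0 ≤ criticalBeta d := (criticalBeta_pos_holds (d := d) (by omega)).le
  have h0 : ∀ x, 0 ≤ twoPointFree d (criticalBeta d) x := fun x =>
    twoPointFree_nonneg hasBoxLimit_isingCorr_free_holds
      (fun {_ _ _ _ _} => GKSInequalities.gks_one_holds (zdGraph d)) hβc x
  set g : Site d → NNReal := fun x => (twoPointFree d (criticalBeta d) x ^ 2).toNNReal with hg
  have hfun : (fun x => (g x : ENNReal)) = fun x => ENNReal.ofReal (twoPointFree d (criticalBeta d) x) ^ 2 := by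
    funext x
    rw [← ENNReal.ofReal_pow (h0 x)]
    rfl
  have hne : (∑' x, (g x : ENNReal)) ≠ ⊤ := by rw [hfun]; exact hlt.ne
  have hs := ENNReal.tsum_coe_ne_top_iff_summable_coe.1 hne
  refine hs.congr fun x => ?_
  simp only [hg, Real.coe_toNNReal _ (sq_nonneg _)]

/-- **The torus bubble converges to the infinite-volume bubble below `β_c`** (`d ≥ 2`,
`0 ≤ β < β_c`, along any tori `N_j → ∞`): `B_{N_j}(β) → ∑_x ⟨σ_0σ_x⟩²_β`. Dominated convergence
over `ℤ^d` through the centred representatives (`sum_torus_eq_sum_centredCube`): pointwise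
convergence of the periodic two-point function (`tendsto_isingTorusTwoPoint_proj`, Griffiths
sandwich; Aizenman–Duminil-Copin 2021, Prop. 5.2) and the domination
`⟨σ_0σ_{x̄}⟩²_{𝕋_N} ≤ ⟨σ_0σ_{x̄}⟩_{𝕋_N} ≤ θ^{⌊‖x‖_∞/(R+1)⌋}` uniformly in `N`
(`exists_uniform_decay_isingTorusTwoPoint`, Duminil-Copin–Tassion 2016). [cite: AizenmanDuminilCopinAnnals2021, arXiv:1912.07973 Prop. 5.2 (p. 17)] [cite: DuminilCopinTassionCMP2016, Thm. 2.1 (3), Lemma 2.7, §2.5] -/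
theorem tendsto_torusBubble (hd : 2 ≤ d) {β : ℝ} (hβ : 0 ≤ β) (hβc : β < criticalBeta d)
    {Nseq : ℕ → ℕ} [∀ j, NeZero (Nseq j)] (hN : Tendsto Nseq atTop atTop) :
    Tendsto (fun j => torusBubble d (Nseq j) β) atTop (𝓝 (∑' x : Site d, twoPointPlus d β x ^ 2)) := by
  classical
  -- the uniform decay and a summable exponential majorant (as in `tendsto_twoPointFourierTorus_re`)
  obtain ⟨R, θ, hR1, hθ0, hθ1, hdecay⟩ := exists_uniform_decay_isingTorusTwoPoint hd hβ hβc
  set θ' : ℝ := max θ (1 / 2) with hθ'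
  have hθ'pos : 0 < θ' := lt_max_of_lt_right one_half_pos
  have hθ'1 : θ' < 1 := max_lt hθ1 one_half_lt_one
  have hθθ' : θ ≤ θ' := le_max_left _ _
  set c : ℝ := -Real.log θ' / (R + 1) with hc
  have hcpos : 0 < c := div_pos (neg_pos.2 (Real.log_neg hθ'pos hθ'1)) (by positivity)
  set bound : Site d → ℝ := fun x => θ'⁻¹ * Real.exp (-c * ‖x‖) with hbound
  have hbound_summ : Summable bound := by
    obtain ⟨B, hB⟩ := sum_box_exp_neg_mul_norm_le (d := d) hcpos
    have hs : Summable fun x : Site d => Real.exp (-c * ‖x‖) := by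
      refine summable_of_sum_le (c := B) (fun x => (Real.exp_pos _).le) fun s => ?_
      obtain ⟨N, hN⟩ := exists_forall_subset_box d s
      exact (Finset.sum_le_sum_of_subset_of_nonneg (hN N le_rfl) fun x _ _ => (Real.exp_pos _).le).trans (hB N)
    exact hs.mul_left θ'⁻¹
  have hpow_le : ∀ x : Site d, θ ^ (Site.supNorm x / (R + 1)) ≤ bound x := by
    intro x
    refine (pow_le_pow_left₀ hθ0 hθθ' _).trans ?_
    have := pow_div_le_inv_mul_exp hθ'pos hθ'1.le (L := R + 1) (by omega) (Site.supNorm x)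
    show θ' ^ (Site.supNorm x / (R + 1)) ≤ θ'⁻¹ * Real.exp (-c * ‖x‖)
    rw [Site.norm_eq_supNorm]
    push_cast at this ⊢
    exact this
  -- the terms as functions on `ℤ^d`
  set f : ℕ → Site d → ℝ := fun j x => if x ∈ centredCube d (Nseq j) then
    isingTorusTwoPoint d (Nseq j) β 0 0 (Torus.proj (Nseq j) x) ^ 2 else 0 with hf
  have hsum : ∀ j, torusBubble d (Nseq j) β = ∑' x, f j x := by
    intro j
    rw [torusBubble, sum_torus_eq_sum_centredCube, tsum_eq_sum (s := centredCube d (Nseq j))]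
    · exact Finset.sum_congr rfl fun x hx => by rw [hf]; simp only [if_pos hx]
    · intro x hx; rw [hf]; simp only [if_neg hx]
  simp only [hsum]
  refine tendsto_tsum_of_dominated_convergence hbound_summ (fun x => ?_) ?_
  · -- pointwise convergence at a fixed `x`
    have hmem : ∀ᶠ j in atTop, x ∈ centredCube d (Nseq j) := by
      filter_upwards [hN.eventually (eventually_gt_atTop (2 * Site.supNorm x))] with j hj
      rw [mem_centredCube]
      intro i
      have := Site.natAbs_le_supNorm x i
      constructor <;> omega
    have hG := (tendsto_isingTorusTwoPoint_proj hβ hβc hN x).pow 2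
    refine hG.congr' ?_
    filter_upwards [hmem] with j hj
    rw [hf]; simp only [if_pos hj]
  · -- domination, for `N_j ≥ 2R + 4`
    filter_upwards [hN.eventually (eventually_ge_atTop (2 * R + 4))] with j hj x
    rw [hf]
    simp only
    split_ifs with hx
    · have h2 := two_mul_supNorm_le_of_mem_centredCube hx
      obtain ⟨hG0, hGle⟩ := hdecay (Nseq j) hj x h2
      have hG1 := isingTorusTwoPoint_le_one (d := d) (N := Nseq j) β 0 0 (Torus.proj (Nseq j) x)
      rw [Real.norm_eq_abs, abs_of_nonneg (sq_nonneg _)]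
      calc isingTorusTwoPoint d (Nseq j) β 0 0 (Torus.proj (Nseq j) x) ^ 2
          ≤ isingTorusTwoPoint d (Nseq j) β 0 0 (Torus.proj (Nseq j) x) := by
            rw [sq]; exact mul_le_of_le_one_left hG0 hG1
        _ ≤ θ ^ (Site.supNorm x / (R + 1)) := hGle
        _ ≤ bound x := hpow_le x
    · rw [norm_zero]
      exact mul_nonneg (inv_nonneg.2 hθ'pos.le) (Real.exp_pos _).le

/-- `1 ≤ B_L(β)` (the diagonal term `⟨σ_0σ_0⟩² = 1`). [folklore] -/
theorem one_le_torusBubble {L : ℕ} [NeZero L] (β : ℝ) : 1 ≤ torusBubble d L β := by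
  unfold torusBubble
  have h0 : isingTorusTwoPoint d L β 0 0 0 ^ 2 = 1 := by simp [isingTorusTwoPoint]
  calc (1 : ℝ) = isingTorusTwoPoint d L β 0 0 0 ^ 2 := h0.symm
    _ ≤ ∑ y : TorusSite d L, isingTorusTwoPoint d L β 0 0 y ^ 2 :=
        Finset.single_le_sum (f := fun y => isingTorusTwoPoint d L β 0 0 y ^ 2)
          (fun y _ => sq_nonneg _) (Finset.mem_univ 0)

/-- **Uniform bound on the torus bubble below `β_c` in `d ≥ 5`** (Fernández–Fröhlich–Sokal 1992,
§14.4.2, Step 2 (a): "We know already that `B₀(t) ≤ const` [bubble bound (14.9)]"; finite-volume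
form): there is `B ≥ 1` such that for every `0 ≤ β < β_c` all large tori have `B_L(β) ≤ B`.
Indeed `B_L(β) → ∑_x ⟨σ_0σ_x⟩²_β` (`tendsto_torusBubble`), and
`⟨σ_0σ_x⟩_β = ⟨σ_0σ_x⟩^∅_β ≤ ⟨σ_0σ_x⟩^∅_{β_c}` (uniqueness below `β_c`, Griffiths monotonicity in
`β`), whose squares are summable in `d ≥ 5` (`summable_twoPointFree_criticalBeta_sq`); take
`B = ∑_x ⟨σ_0σ_x⟩²_{β_c} + 1`. [cite: FernandezFrohlichSokalSpringer1992, §14.4.2, Step 2 (a), p. 353, with (14.9)] [cite: Sakai2007, §1.1 (bubble condition above four dimensions)] -/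
theorem exists_torusBubble_le (hd : 5 ≤ d) :
    ∃ B : ℝ, 1 ≤ B ∧ ∀ β : ℝ, 0 ≤ β → β < criticalBeta d →
      ∃ L₀ : ℕ, ∀ L : ℕ, L₀ ≤ L → ∀ [NeZero L], torusBubble d L β ≤ B := by
  have hsc := summable_twoPointFree_criticalBeta_sq hd
  set Bc : ℝ := ∑' x : Site d, twoPointFree d (criticalBeta d) x ^ 2 with hBc
  have hBc0 : 0 ≤ Bc := tsum_nonneg fun x => sq_nonneg _
  refine ⟨Bc + 1, by linarith, fun β hβ hβc => ?_⟩
  have hle : ∀ x, twoPointPlus d β x ^ 2 ≤ twoPointFree d (criticalBeta d) x ^ 2 := by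
    intro x
    have h1 : twoPointPlus d β x = twoPointFree d β x :=
      (twoPointFree_eq_twoPointPlus_of_spontaneousMagnetization_eq_zero hβ
        (spontaneousMagnetization_eq_zero_of_lt_criticalBeta_holds hβ hβc) x).symm
    have h2 : twoPointFree d β x ≤ twoPointFree d (criticalBeta d) x :=
      twoPointFree_mono_beta isingCorr_free_mono_beta_holds hasBoxLimit_isingCorr_free_holds hβ
        hβc.le x
    have h3 : 0 ≤ twoPointPlus d β x := twoPointPlus_nonneg_of_gks hβ x
    rw [← h1] at h2
    exact pow_le_pow_left₀ h3 h2 2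
  have hsβ : Summable fun x => twoPointPlus d β x ^ 2 :=
    hsc.of_nonneg_of_le (fun x => sq_nonneg _) hle
  have hBβ : ∑' x, twoPointPlus d β x ^ 2 ≤ Bc := hsβ.tsum_le_tsum hle hsc
  have hlim := tendsto_torusBubble (d := d) (by omega) hβ hβc (Nseq := fun j => j + 1)
    (tendsto_add_atTop_nat 1)
  have hev : ∀ᶠ j : ℕ in atTop, torusBubble d (j + 1) β < Bc + 1 :=
    hlim.eventually (gt_mem_nhds (by linarith))
  obtain ⟨j₀, hj₀⟩ := eventually_atTop.1 hev
  refine ⟨j₀ + 1, fun L hL _ => ?_⟩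
  obtain ⟨j, rfl⟩ : ∃ j, L = j + 1 := ⟨L - 1, by omega⟩
  exact (hj₀ j (by omega)).le

end Bubble

/-! ## Part G. From the Aizenman–Fernández inequality (13.65) on tori to the critical isotherm and the target -/

section AFe

/-- **The critical-isotherm bound (upper half of `δ = 3`, `d ≥ 5`) from the Aizenman–Fernández
inequality on finite tori.** Hypothesis `hAFe` is the AFe inequality of Fernández–Fröhlich–Sokal 1992, Thm. 12.15 in the form
(13.65), `ū₃ ≤ -[1 - B₀ (tanh h)/M] (tanh h) χ⁴ / (96 B₀ (1 + 2|J|B₀)²)` ("for translation-invariant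
Ising models"; proved in Aizenman–Fernández 1986 and not reproduced in FFS), written for the
nearest-neighbour model on every discrete torus `(ℤ/Lℤ)^d`, `d ≥ 5`, at every `β > 0` and
physical field `βh > 0`: `M = torusMag`, `χ = torusSusc = ∂M/∂(βh)`, `ū₃ = torusU3 = ∂χ/∂(βh)`,
`B₀ = torusBubble` (bubble at `h = 0`), `|J| = ∑_y J_{0y} = 2dβ`. Conclusion: the upper half of
`δ = 3`, `⟨σ_0⟩⁺_{β_c,h} ≤ C h^{1/3}` for small `h > 0` in `d ≥ 5` (FFS §14.4.2, Step 1 and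
Step 2 (a): the uniform torus bubble bound `exists_torusBubble_le` turns (13.65) into the shape
hypothesis of `criticalIsotherm_le_cbrt_of_torusShape` with `a = 1/2`, using `tanh(βh) ≤ βh`). [cite: FernandezFrohlichSokalSpringer1992, Thm. 12.15 / eq. (13.65), pp. 263, 290, and §14.4.2, Step 1–2(a), eqs. (14.278)–(14.282), pp. 352–353] [cite: AizenmanFernandezJSP1986, abstract and §1 (δ = 3 for nearest-neighbour models, d > 4; Zbl 0629.60106)] -/
theorem criticalIsotherm_le_cbrt_of_afeTorus
    (hAFe : ∀ ⦃d : ℕ⦄, 5 ≤ d → ∀ (L : ℕ) [NeZero L] (β h : ℝ), 0 < β → 0 < h →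
      torusU3 d L β h ≤
        -((1 - torusBubble d L β * Real.tanh (β * h) / torusMag d L β h) /
            (96 * torusBubble d L β * (1 + 2 * (2 * d * β) * torusBubble d L β) ^ 2)) *
          Real.tanh (β * h) * torusSusc d L β h ^ 4) :
    ∀ ⦃d : ℕ⦄, 5 ≤ d → ∃ C h₁ : ℝ, 0 < h₁ ∧ ∀ h ∈ Set.Ioo (0 : ℝ) h₁,
      magnetizationInField d (criticalBeta d) h ≤ C * h ^ (1 / 3 : ℝ) := by
  refine criticalIsotherm_le_cbrt_of_torusShape fun d hd => ?_
  obtain ⟨B, hB1, hB⟩ := exists_torusBubble_le (d := d) hd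
  have hβc : 0 < criticalBeta d := criticalBeta_pos_holds (d := d) (by omega)
  have hB0 : 0 < B := by linarith
  set D : ℝ := 96 * B * (1 + 2 * (2 * d * criticalBeta d) * B) ^ 2 with hD
  have hD0 : 0 < D := by positivity
  refine ⟨0, 1, 1 / (2 * D), 1 / 2, B, hβc, one_pos, by positivity, one_half_pos, hB0.le,
    fun β hβ hβ0 => ?_⟩
  obtain ⟨L₀, hL₀⟩ := hB β hβ0.le hβ.2
  refine ⟨L₀, fun L hL _ h hh hsmall => ?_⟩
  have hBL : torusBubble d L β ≤ B := hL₀ L hL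
  have hBL1 : 1 ≤ torusBubble d L β := one_le_torusBubble β
  have hBL0 : 0 < torusBubble d L β := by linarith
  have hth0 : 0 ≤ Real.tanh (β * h) := by
    rw [Real.tanh_eq_sinh_div_cosh]
    exact div_nonneg (Real.sinh_nonneg_iff.2 (mul_pos hβ0 hh.1).le) (Real.cosh_pos _).le
  -- `tanh x ≤ x` for `x ≥ 0` (`t cosh t - sinh t` is nondecreasing on `[0, ∞)`, derivative `t sinh t`)
  have tanh_le : ∀ {x : ℝ}, 0 ≤ x → Real.tanh x ≤ x := by
    intro x hx
    rw [Real.tanh_eq_sinh_div_cosh, div_le_iff₀ (Real.cosh_pos x)]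
    have hder : ∀ t : ℝ, HasDerivAt (fun t => t * Real.cosh t - Real.sinh t) (t * Real.sinh t) t := by
      intro t
      have h1 : HasDerivAt (fun t => t * Real.cosh t - Real.sinh t)
          (1 * Real.cosh t + t * Real.sinh t - Real.cosh t) t :=
        ((hasDerivAt_id' t).mul (Real.hasDerivAt_cosh t)).sub (Real.hasDerivAt_sinh t)
      exact h1.congr_deriv (by ring)
    have hmono : MonotoneOn (fun t => t * Real.cosh t - Real.sinh t) (Ici 0) := by
      refine monotoneOn_of_deriv_nonneg (convex_Ici 0)
        (fun t _ => (hder t).continuousAt.continuousWithinAt)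
        (fun t _ => (hder t).differentiableAt.differentiableWithinAt) fun t ht => ?_
      rw [interior_Ici] at ht
      rw [(hder t).deriv]
      exact mul_nonneg (le_of_lt ht) (Real.sinh_nonneg_iff.2 (le_of_lt ht))
    have := hmono (self_mem_Ici) (mem_Ici.2 hx) hx
    simp only [zero_mul, Real.sinh_zero, sub_zero] at this
    linarith
  have hth1 : Real.tanh (β * h) ≤ β * h := tanh_le (mul_pos hβ0 hh.1).le
  have hMpos : 0 < torusMag d L β h := by
    have : 0 < B * (β * h) := mul_pos hB0 (mul_pos hβ0 hh.1)
    linarith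
  have hF : 1 / 2 ≤ 1 - torusBubble d L β * Real.tanh (β * h) / torusMag d L β h := by
    have h1 : torusBubble d L β * Real.tanh (β * h) ≤ B * (β * h) :=
      mul_le_mul hBL hth1 hth0 hB0.le
    have h2 : torusBubble d L β * Real.tanh (β * h) / torusMag d L β h ≤ 1 / 2 := by
      rw [div_le_iff₀ hMpos]
      linarith
    linarith
  have hDL0 : 0 < 96 * torusBubble d L β * (1 + 2 * (2 * d * β) * torusBubble d L β) ^ 2 := by
    positivity
  have hDL : 96 * torusBubble d L β * (1 + 2 * (2 * d * β) * torusBubble d L β) ^ 2 ≤ D := by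
    have h1 : 2 * (2 * (d : ℝ) * β) * torusBubble d L β ≤ 2 * (2 * d * criticalBeta d) * B :=
      mul_le_mul (by nlinarith [hβ.2.le, (Nat.cast_nonneg d : (0 : ℝ) ≤ d)]) hBL hBL0.le
        (by positivity)
    have h1' : 0 ≤ 1 + 2 * (2 * (d : ℝ) * β) * torusBubble d L β := by positivity
    have h2 : (1 + 2 * (2 * (d : ℝ) * β) * torusBubble d L β) ^ 2 ≤
        (1 + 2 * (2 * d * criticalBeta d) * B) ^ 2 :=
      pow_le_pow_left₀ h1' (by linarith) 2
    exact mul_le_mul (by nlinarith) h2 (by positivity) (by positivity)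
  have hcoef : 1 / (2 * D) ≤ (1 - torusBubble d L β * Real.tanh (β * h) / torusMag d L β h) /
      (96 * torusBubble d L β * (1 + 2 * (2 * d * β) * torusBubble d L β) ^ 2) := by
    rw [show 1 / (2 * D) = (1 / 2) / D by ring]
    exact div_le_div₀ (by linarith) hF hDL0 hDL
  have key := hAFe hd L β h hβ0 hh.1
  have hx : 0 ≤ Real.tanh (β * h) * torusSusc d L β h ^ 4 := by positivity
  nlinarith [mul_le_mul_of_nonneg_right hcoef hx]

/-- **The target `spontaneousMagnetization_le_sqrt` from the Aizenman–Fernández inequality on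
finite tori** (`criticalIsotherm_le_cbrt_of_afeTorus` and the extrapolation principle of the
parent file): with (13.65) on every torus, `m*(β) ≤ C (β - β_c)^{1/2}` near `β_c⁺` for `d ≥ 5`
(Aizenman–Fernández 1986; FFS §14.4.2 Step 2 (a), (14.284)). [cite: FernandezFrohlichSokalSpringer1992, §14.4.2, Step 2 (a), eqs. (14.283)–(14.284), p. 353, with Thm. 12.15 / (13.65)] [cite: AizenmanFernandezJSP1986, abstract and §1 (β = 1/2 for nearest-neighbour models, d > 4; Zbl 0629.60106)] -/
theorem spontaneousMagnetization_le_sqrt_of_afeTorus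
    (hAFe : ∀ ⦃d : ℕ⦄, 5 ≤ d → ∀ (L : ℕ) [NeZero L] (β h : ℝ), 0 < β → 0 < h →
      torusU3 d L β h ≤
        -((1 - torusBubble d L β * Real.tanh (β * h) / torusMag d L β h) /
            (96 * torusBubble d L β * (1 + 2 * (2 * d * β) * torusBubble d L β) ^ 2)) *
          Real.tanh (β * h) * torusSusc d L β h ^ 4) :
    spontaneousMagnetization_le_sqrt :=
  spontaneousMagnetization_le_sqrt_of_criticalIsotherm (criticalIsotherm_le_cbrt_of_afeTorus hAFe)

end AFe

/-! ## Part H. From the Aizenman–Fernández lower bound (5.33) in its weakest useful form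

Aizenman–Fernández 1986 prove their main differential inequality (1.15) as Theorem 5.7 (b),
eq. (5.33): in a finite translation-invariant (periodic) ferromagnetic Ising system, for
`β ≥ β_c/24` (what the proof uses is `24β|J| ≥ 1`, to make the dilution density
`p = C₁/(24C₂) ≤ 1`, p. 441),
`|∂χ/∂(βh)| ≥ [1 - B₀ tanh(βh)/M]₊ tanh(βh) χ⁴ / (48 [1 + M tanh(βh)] B₀ (1 + 2β|J|B₀)²)`,
with `∂χ/∂(βh) = ū₃ ≤ 0`. Fernández–Fröhlich–Sokal print it as (13.65) with `96` for
`48[1 + M tanh(βh)]`. Whatever the constants, on the event `2B₀ tanh(βh) ≤ M` every such form gives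
`ū₃ ≤ -c tanh(βh) χ⁴ / (B₀(1 + 2β|J|B₀)²)` for some absolute `c > 0`; the theorems below take
exactly this consequence — on the tori `(ℤ/Lℤ)^d`, for `β` in some left neighbourhood of `β_c`,
`L` large and `h` small — as hypothesis, so that any faithful formalisation of (5.33) on tori
discharges them. -/

section AFeLite

/-- **The critical-isotherm bound (upper half of `δ = 3`, `d ≥ 5`) from the weak form of the
Aizenman–Fernández inequality (5.33) on large tori near `β_c`.** Hypothesis: for `d ≥ 5` there are
`c > 0`, `β₁ < β_c`, `h₀ > 0`, `L₁` such that for `β ∈ (β₁, β_c)`, `β > 0`, `L ≥ L₁`,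
`h ∈ (0, h₀]`: `2 B_L tanh(βh) ≤ M_L ⟹ ū₃,L ≤ -c tanh(βh) χ_L⁴ / (B_L (1 + 2(2dβ)B_L)²)`
(`M_L, χ_L, ū₃,L, B_L` = `torusMag, torusSusc, torusU3, torusBubble`; `|J| = 2d` in coupling units,
`β|J| = 2dβ`). This is implied by Aizenman–Fernández 1986, Thm. 5.7 (b), eq. (5.33) (there with
`c = 1/192`: `[1 - B₀ tanh/M]₊ ≥ 1/2` on the event, `48[1 + M tanh] ≤ 96`). Conclusion:
`⟨σ₀⟩⁺_{β_c,h} ≤ C h^{1/3}` for small `h > 0` — via the uniform torus bubble bound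
`exists_torusBubble_le`, `tanh(βh) ≤ βh` and `criticalIsotherm_le_cbrt_of_torusShape`
(FFS §14.4.2, Step 1). The inequality (5.33) itself is NOT proved here. [cite: AizenmanFernandezJSP1986, Thm. 5.7 (b), eq. (5.33), p. 435, and §2.1, eqs. (2.2)–(2.4), pp. 400–401] [cite: FernandezFrohlichSokalSpringer1992, eq. (13.65), p. 290, and §14.4.2, Step 1, eqs. (14.278)–(14.282), pp. 352–353] -/
theorem criticalIsotherm_le_cbrt_of_afeLite
    (hAF : ∀ ⦃d : ℕ⦄, 5 ≤ d → ∃ c β₁ h₀ : ℝ, ∃ L₁ : ℕ, 0 < c ∧ β₁ < criticalBeta d ∧ 0 < h₀ ∧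
      ∀ β ∈ Set.Ioo β₁ (criticalBeta d), 0 < β → ∀ L : ℕ, L₁ ≤ L → ∀ [NeZero L],
        ∀ h ∈ Set.Ioc (0 : ℝ) h₀, 2 * torusBubble d L β * Real.tanh (β * h) ≤ torusMag d L β h →
          torusU3 d L β h ≤ -(c * Real.tanh (β * h) * torusSusc d L β h ^ 4 /
            (torusBubble d L β * (1 + 2 * (2 * d * β) * torusBubble d L β) ^ 2))) :
    ∀ ⦃d : ℕ⦄, 5 ≤ d → ∃ C h₁ : ℝ, 0 < h₁ ∧ ∀ h ∈ Set.Ioo (0 : ℝ) h₁,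
      magnetizationInField d (criticalBeta d) h ≤ C * h ^ (1 / 3 : ℝ) := by
  refine criticalIsotherm_le_cbrt_of_torusShape fun d hd => ?_
  obtain ⟨c, β₁, h₀, L₁, hc, hβ₁, hh₀, hH⟩ := hAF hd
  obtain ⟨B, hB1, hB⟩ := exists_torusBubble_le (d := d) hd
  have hβc : 0 < criticalBeta d := criticalBeta_pos_holds (d := d) (by omega)
  have hB0 : 0 < B := by linarith
  set D : ℝ := B * (1 + 2 * (2 * d * criticalBeta d) * B) ^ 2 with hD
  have hD0 : 0 < D := by positivity
  refine ⟨β₁, h₀, c / D, 1 / 2, B, hβ₁, hh₀, div_pos hc hD0, one_half_pos, hB0.le,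
    fun β hβ hβ0 => ?_⟩
  obtain ⟨L₀, hL₀⟩ := hB β hβ0.le hβ.2
  refine ⟨max L₀ L₁, fun L hL _ h hh hsmall => ?_⟩
  have hBL : torusBubble d L β ≤ B := hL₀ L (le_of_max_le_left hL)
  have hBL1 : 1 ≤ torusBubble d L β := one_le_torusBubble β
  have hBL0 : 0 < torusBubble d L β := by linarith
  have hth0 : 0 ≤ Real.tanh (β * h) := by
    rw [Real.tanh_eq_sinh_div_cosh]
    exact div_nonneg (Real.sinh_nonneg_iff.2 (mul_pos hβ0 hh.1).le) (Real.cosh_pos _).le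
  -- `tanh x ≤ x` for `x ≥ 0` (`t cosh t - sinh t` is nondecreasing on `[0, ∞)`, derivative `t sinh t`)
  have tanh_le : ∀ {x : ℝ}, 0 ≤ x → Real.tanh x ≤ x := by
    intro x hx
    rw [Real.tanh_eq_sinh_div_cosh, div_le_iff₀ (Real.cosh_pos x)]
    have hder : ∀ t : ℝ, HasDerivAt (fun t => t * Real.cosh t - Real.sinh t) (t * Real.sinh t) t := by
      intro t
      have h1 : HasDerivAt (fun t => t * Real.cosh t - Real.sinh t)
          (1 * Real.cosh t + t * Real.sinh t - Real.cosh t) t :=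
        ((hasDerivAt_id' t).mul (Real.hasDerivAt_cosh t)).sub (Real.hasDerivAt_sinh t)
      exact h1.congr_deriv (by ring)
    have hmono : MonotoneOn (fun t => t * Real.cosh t - Real.sinh t) (Ici 0) := by
      refine monotoneOn_of_deriv_nonneg (convex_Ici 0)
        (fun t _ => (hder t).continuousAt.continuousWithinAt)
        (fun t _ => (hder t).differentiableAt.differentiableWithinAt) fun t ht => ?_
      rw [interior_Ici] at ht
      rw [(hder t).deriv]
      exact mul_nonneg (le_of_lt ht) (Real.sinh_nonneg_iff.2 (le_of_lt ht))
    have := hmono (self_mem_Ici) (mem_Ici.2 hx) hx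
    simp only [zero_mul, Real.sinh_zero, sub_zero] at this
    linarith
  have hth1 : Real.tanh (β * h) ≤ β * h := tanh_le (mul_pos hβ0 hh.1).le
  -- on the event `B βh ≤ M/2` we have `2 B_L tanh(βh) ≤ M_L`
  have hev : 2 * torusBubble d L β * Real.tanh (β * h) ≤ torusMag d L β h := by
    have h1 : torusBubble d L β * Real.tanh (β * h) ≤ B * (β * h) :=
      mul_le_mul hBL hth1 hth0 hB0.le
    linarith
  have key := hH β hβ hβ0 L (le_of_max_le_right hL) h hh hev
  -- compare the denominators: `B_L (1 + 2(2dβ)B_L)² ≤ B (1 + 2(2dβ_c)B)² = D`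
  have hDL0 : 0 < torusBubble d L β * (1 + 2 * (2 * d * β) * torusBubble d L β) ^ 2 := by
    positivity
  have hDL : torusBubble d L β * (1 + 2 * (2 * d * β) * torusBubble d L β) ^ 2 ≤ D := by
    have h1 : 2 * (2 * (d : ℝ) * β) * torusBubble d L β ≤ 2 * (2 * d * criticalBeta d) * B :=
      mul_le_mul (by nlinarith [hβ.2.le, (Nat.cast_nonneg d : (0 : ℝ) ≤ d)]) hBL hBL0.le
        (by positivity)
    have h1' : 0 ≤ 1 + 2 * (2 * (d : ℝ) * β) * torusBubble d L β := by positivity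
    have h2 : (1 + 2 * (2 * (d : ℝ) * β) * torusBubble d L β) ^ 2 ≤
        (1 + 2 * (2 * d * criticalBeta d) * B) ^ 2 :=
      pow_le_pow_left₀ h1' (by linarith) 2
    exact mul_le_mul hBL h2 (by positivity) hB0.le
  have hx : 0 ≤ c * Real.tanh (β * h) * torusSusc d L β h ^ 4 := by positivity
  have hcmp : c / D * Real.tanh (β * h) * torusSusc d L β h ^ 4 ≤
      c * Real.tanh (β * h) * torusSusc d L β h ^ 4 /
        (torusBubble d L β * (1 + 2 * (2 * d * β) * torusBubble d L β) ^ 2) := by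
    rw [div_mul_eq_mul_div, div_mul_eq_mul_div]
    exact div_le_div_of_nonneg_left hx hDL0 hDL
  linarith

/-- **The target `spontaneousMagnetization_le_sqrt` from the weak form of the Aizenman–Fernández
inequality (5.33) on large tori near `β_c`** (`criticalIsotherm_le_cbrt_of_afeLite` and the
extrapolation principle of the parent file, `spontaneousMagnetization_le_sqrt_of_criticalIsotherm`):
`m*(β) ≤ C (β - β_c)^{1/2}` near `β_c⁺` for `d ≥ 5` (Aizenman–Fernández 1986, (1.9) Case 1;
FFS §14.4.2 Step 2 (a), (14.284)). [cite: AizenmanFernandezJSP1986, Thm. 5.7 (b), eq. (5.33), p. 435, with §2, (1.9) Case 1] [cite: FernandezFrohlichSokalSpringer1992, §14.4.2, Step 2 (a), eqs. (14.283)–(14.284), p. 353] -/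
theorem spontaneousMagnetization_le_sqrt_of_afeLite
    (hAF : ∀ ⦃d : ℕ⦄, 5 ≤ d → ∃ c β₁ h₀ : ℝ, ∃ L₁ : ℕ, 0 < c ∧ β₁ < criticalBeta d ∧ 0 < h₀ ∧
      ∀ β ∈ Set.Ioo β₁ (criticalBeta d), 0 < β → ∀ L : ℕ, L₁ ≤ L → ∀ [NeZero L],
        ∀ h ∈ Set.Ioc (0 : ℝ) h₀, 2 * torusBubble d L β * Real.tanh (β * h) ≤ torusMag d L β h →
          torusU3 d L β h ≤ -(c * Real.tanh (β * h) * torusSusc d L β h ^ 4 /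
            (torusBubble d L β * (1 + 2 * (2 * d * β) * torusBubble d L β) ^ 2))) :
    spontaneousMagnetization_le_sqrt :=
  spontaneousMagnetization_le_sqrt_of_criticalIsotherm (criticalIsotherm_le_cbrt_of_afeLite hAF)

/-- **The verbatim torus form (13.65) implies the weak form** used above (so Part G is a special
case of Part H): from `hAFe` of `criticalIsotherm_le_cbrt_of_afeTorus` one gets the hypothesis of
`criticalIsotherm_le_cbrt_of_afeLite` with `c = 1/192`, `β₁ = 0`, `h₀ = 1`, `L₁ = 0`. [cite: FernandezFrohlichSokalSpringer1992, eq. (13.65), p. 290] [cite: AizenmanFernandezJSP1986, Thm. 5.7 (b), eq. (5.33), p. 435] -/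
theorem afeLite_of_afeTorus
    (hAFe : ∀ ⦃d : ℕ⦄, 5 ≤ d → ∀ (L : ℕ) [NeZero L] (β h : ℝ), 0 < β → 0 < h →
      torusU3 d L β h ≤
        -((1 - torusBubble d L β * Real.tanh (β * h) / torusMag d L β h) /
            (96 * torusBubble d L β * (1 + 2 * (2 * d * β) * torusBubble d L β) ^ 2)) *
          Real.tanh (β * h) * torusSusc d L β h ^ 4) :
    ∀ ⦃d : ℕ⦄, 5 ≤ d → ∃ c β₁ h₀ : ℝ, ∃ L₁ : ℕ, 0 < c ∧ β₁ < criticalBeta d ∧ 0 < h₀ ∧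
      ∀ β ∈ Set.Ioo β₁ (criticalBeta d), 0 < β → ∀ L : ℕ, L₁ ≤ L → ∀ [NeZero L],
        ∀ h ∈ Set.Ioc (0 : ℝ) h₀, 2 * torusBubble d L β * Real.tanh (β * h) ≤ torusMag d L β h →
          torusU3 d L β h ≤ -(c * Real.tanh (β * h) * torusSusc d L β h ^ 4 /
            (torusBubble d L β * (1 + 2 * (2 * d * β) * torusBubble d L β) ^ 2)) := by
  intro d hd
  have hβc : 0 < criticalBeta d := criticalBeta_pos_holds (d := d) (by omega)
  refine ⟨1 / 192, 0, 1, 0, by norm_num, hβc, one_pos, fun β hβ hβ0 L _ _ h hh hev => ?_⟩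
  have key := hAFe hd L β h hβ0 hh.1
  have hBL1 : 1 ≤ torusBubble d L β := one_le_torusBubble β
  have hBL0 : 0 < torusBubble d L β := by linarith
  have hth0 : 0 ≤ Real.tanh (β * h) := by
    rw [Real.tanh_eq_sinh_div_cosh]
    exact div_nonneg (Real.sinh_nonneg_iff.2 (mul_pos hβ0 hh.1).le) (Real.cosh_pos _).le
  have hMpos : 0 < torusMag d L β h := by
    -- `M_L > 0` at `β, h > 0`: `M_L ≥ 2 B_L tanh(βh) ≥ 0`, and `M_L = 0` would force `tanh(βh) = 0`
    rcases (torusMag_nonneg (d := d) (L := L) hβ0.le hh.1.le).lt_or_eq with hpos | h0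
    · exact hpos
    · exfalso
      have hth : 0 < Real.tanh (β * h) := by
        rw [Real.tanh_eq_sinh_div_cosh]
        exact div_pos (Real.sinh_pos_iff.2 (mul_pos hβ0 hh.1)) (Real.cosh_pos _)
      have : 2 * torusBubble d L β * Real.tanh (β * h) ≤ 0 := by rw [h0]; exact hev
      nlinarith
  have hF : 1 / 2 ≤ 1 - torusBubble d L β * Real.tanh (β * h) / torusMag d L β h := by
    have h2 : torusBubble d L β * Real.tanh (β * h) / torusMag d L β h ≤ 1 / 2 := by
      rw [div_le_iff₀ hMpos]; linarith
    linarith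
  set Den : ℝ := torusBubble d L β * (1 + 2 * (2 * d * β) * torusBubble d L β) ^ 2 with hDen
  have hDen0 : 0 < Den := by positivity
  have hx : 0 ≤ Real.tanh (β * h) * torusSusc d L β h ^ 4 := by positivity
  have hcoef : 1 / 192 / Den ≤ (1 - torusBubble d L β * Real.tanh (β * h) / torusMag d L β h) /
      (96 * torusBubble d L β * (1 + 2 * (2 * d * β) * torusBubble d L β) ^ 2) := by
    rw [show 96 * torusBubble d L β * (1 + 2 * (2 * d * β) * torusBubble d L β) ^ 2 = 96 * Den by
      rw [hDen]; ring, show (1 : ℝ) / 192 / Den = (1 / 2) / (96 * Den) by field_simp; ring]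
    exact div_le_div_of_nonneg_right hF (by positivity)
  have h1 : 1 / 192 * Real.tanh (β * h) * torusSusc d L β h ^ 4 / Den =
      1 / 192 / Den * (Real.tanh (β * h) * torusSusc d L β h ^ 4) := by ring
  rw [h1]
  nlinarith [mul_le_mul_of_nonneg_right hcoef hx]

end AFeLite

end Literature.Probability.LatticeModels
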